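import Mathlib
import Summits.Ventures.PercRepro2.Defs
import Summits.Ventures.PercRepro2.Graph
import Summits.Ventures.PercRepro2.HullDefs
import Summits.Ventures.PercRepro2.LocRows
import Summits.Ventures.PercRepro2.SwRow

/-!
# Row (SW) across a cut vertex: the gluing vocabulary and the three free placements
(blind cell PercRepro2, night-4 g4, 2026-08-24; proofs/NIGHT4-SIDE.md §5′)

Two graphs `ends₁ : E₁ → Sym2 V`, `ends₂ : E₂ → Sym2 V` on vertex sets `V₁`, `V₂` meeting exactly in
the cut vertex `c` are GLUED into `glue ends₁ ends₂ : E₁ ⊕ E₂ → Sym2 V`; a configuration of the glued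
graph is the pair of its restrictions `ζ ∘ inl`, `ζ ∘ inr`.  A simple path uses `c` at most once, so
(`cluster_glue_eq`) for `v ∈ V₁` the cluster of `v` is its `G₁`-cluster, plus the `G₂`-cluster of `c`
when that `G₁`-cluster contains `c`.  Row (SW) (`LocRows.Sw`, the weight-free base) then composes:
* `sw_glue_cut_l` — `c = l` (`o` on one side, `h` on the other): (SW) holds on the glued graph with NO
  hypothesis (the colour swap of the `h`-side);
* `sw_glue_pendant` — `l, h, o` on the `G₁`-side, `G₂` pendant at `c`: (SW)(G₁) ⟹ (SW)(G);
* `sw_glue_cut_h` — `c = h`, `l, o` on the `G₁`-side: (SW)(G₁) ⟹ (SW)(G).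
The remaining placements (NIGHT4-SIDE.md §5′: `c = o`, and `c` separating two of the marks from the
third) are paper theorems of the same file; their Lean is a later file.
-/

namespace Summit.Ventures.PercRepro2

namespace Glue

open Hull LocRows

open scoped Classical

variable {V : Type*} {E₁ E₂ : Type*}

/-- The glued incidence map. -/
def glue (ends₁ : E₁ → Sym2 V) (ends₂ : E₂ → Sym2 V) : E₁ ⊕ E₂ → Sym2 V := Sum.elim ends₁ ends₂

/-- `c` is a cut vertex of the gluing: the two sides meet exactly in `c` and every edge of a side lies
inside that side. -/
structure IsGluing (ends₁ : E₁ → Sym2 V) (ends₂ : E₂ → Sym2 V) (c : V) (V₁ V₂ : Set V) : Prop where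
  /-- `c` lies on the first side. -/
  c_mem₁ : c ∈ V₁
  /-- `c` lies on the second side. -/
  c_mem₂ : c ∈ V₂
  /-- The sides meet only in `c`. -/
  inter : ∀ x, x ∈ V₁ → x ∈ V₂ → x = c
  /-- Edges of the first side lie inside `V₁`. -/
  mem₁ : ∀ e x, x ∈ ends₁ e → x ∈ V₁
  /-- Edges of the second side lie inside `V₂`. -/
  mem₂ : ∀ e x, x ∈ ends₂ e → x ∈ V₂

variable {ends₁ : E₁ → Sym2 V} {ends₂ : E₂ → Sym2 V} {c : V} {V₁ V₂ : Set V}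

/-- The blue colouring restricts to the sides. -/
lemma blue_comp_inl (ζ : Config (E₁ ⊕ E₂)) : blue ζ ∘ Sum.inl = blue (ζ ∘ Sum.inl) := rfl

/-- The blue colouring restricts to the sides. -/
lemma blue_comp_inr (ζ : Config (E₁ ⊕ E₂)) : blue ζ ∘ Sum.inr = blue (ζ ∘ Sum.inr) := rfl

/-- An open adjacency of the glued graph comes from one of the sides. -/
lemma adj_glue_iff {ζ : Config (E₁ ⊕ E₂)} {x y : V} :
    (openGraph (glue ends₁ ends₂) ζ).Adj x y ↔
      (openGraph ends₁ (ζ ∘ Sum.inl)).Adj x y ∨ (openGraph ends₂ (ζ ∘ Sum.inr)).Adj x y := by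
  simp only [openGraph_adj]
  constructor
  · rintro ⟨hne, e, he, hends⟩
    rcases e with e | e
    · exact Or.inl ⟨hne, e, he, hends⟩
    · exact Or.inr ⟨hne, e, he, hends⟩
  · rintro (⟨hne, e, he, hends⟩ | ⟨hne, e, he, hends⟩)
    · exact ⟨hne, Sum.inl e, he, hends⟩
    · exact ⟨hne, Sum.inr e, he, hends⟩

/-- A cluster of a side stays on that side. -/
lemma cluster_subset_of_mem (hg : IsGluing ends₁ ends₂ c V₁ V₂) {ζ₁ : Config E₁} {v : V}
    (hv : v ∈ V₁) : cluster ends₁ ζ₁ v ⊆ V₁ := by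
  intro u hu
  refine mem_of_conn_of_closed (ends := ends₁) (ω := ζ₁) ?_ hv hu
  intro x _ y hxy
  obtain ⟨_, e, _, hends⟩ := openGraph_adj.1 hxy
  exact hg.mem₁ e y (by rw [hends]; exact Sym2.mem_mk_right x y)

/-- A cluster of the second side stays on that side. -/
lemma cluster_subset_of_mem₂ (hg : IsGluing ends₁ ends₂ c V₁ V₂) {ζ₂ : Config E₂} {v : V}
    (hv : v ∈ V₂) : cluster ends₂ ζ₂ v ⊆ V₂ :=
  cluster_subset_of_mem (IsGluing.mk hg.c_mem₂ hg.c_mem₁ (fun x h₂ h₁ => hg.inter x h₁ h₂) hg.mem₂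
    hg.mem₁) hv

/-- A connection on the first side is a connection of the glued graph. -/
lemma conn_glue_of_conn₁ {ζ : Config (E₁ ⊕ E₂)} {u v : V}
    (h : Conn ends₁ (ζ ∘ Sum.inl) u v) : Conn (glue ends₁ ends₂) ζ u v := by
  have key : v ∈ cluster (glue ends₁ ends₂) ζ u := by
    refine mem_of_conn_of_closed (ends := ends₁) (ω := ζ ∘ Sum.inl) ?_ (mem_cluster_self _ _ _) h
    intro x hx y hxy
    exact mem_cluster_of_adj hx (adj_glue_iff.2 (Or.inl hxy))
  exact key

/-- A connection on the second side is a connection of the glued graph. -/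
lemma conn_glue_of_conn₂ {ζ : Config (E₁ ⊕ E₂)} {u v : V}
    (h : Conn ends₂ (ζ ∘ Sum.inr) u v) : Conn (glue ends₁ ends₂) ζ u v := by
  have key : v ∈ cluster (glue ends₁ ends₂) ζ u := by
    refine mem_of_conn_of_closed (ends := ends₂) (ω := ζ ∘ Sum.inr) ?_ (mem_cluster_self _ _ _) h
    intro x hx y hxy
    exact mem_cluster_of_adj hx (adj_glue_iff.2 (Or.inr hxy))
  exact key

/-- **Cluster decomposition across the cut**: for `v ∈ V₁`, the cluster of `v` in the glued graph is
its `G₁`-cluster, together with the `G₂`-cluster of `c` when the `G₁`-cluster contains `c`. -/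
theorem cluster_glue_eq (hg : IsGluing ends₁ ends₂ c V₁ V₂) {ζ : Config (E₁ ⊕ E₂)} {v : V}
    (hv : v ∈ V₁) :
    cluster (glue ends₁ ends₂) ζ v = cluster ends₁ (ζ ∘ Sum.inl) v ∪
      {x | c ∈ cluster ends₁ (ζ ∘ Sum.inl) v ∧ x ∈ cluster ends₂ (ζ ∘ Sum.inr) c} := by
  apply Set.Subset.antisymm
  · intro u hu
    refine mem_of_conn_of_closed (ends := glue ends₁ ends₂) (ω := ζ) ?_ (Or.inl (mem_cluster_self _ _ _)) hu
    intro x hx y hxy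
    rcases adj_glue_iff.1 hxy with h₁ | h₂
    · -- an edge of the first side: `x ∈ V₁`, and `x` lies in the `G₁`-cluster of `v`
      have hxV₁ : x ∈ V₁ := by
        obtain ⟨_, e, _, hends⟩ := openGraph_adj.1 h₁
        exact hg.mem₁ e x (by rw [hends]; exact Sym2.mem_mk_left x y)
      have hx₁ : x ∈ cluster ends₁ (ζ ∘ Sum.inl) v := by
        rcases hx with hx | ⟨hc, hx₂⟩
        · exact hx
        · have hxV₂ : x ∈ V₂ := cluster_subset_of_mem₂ hg hg.c_mem₂ hx₂
          rw [hg.inter x hxV₁ hxV₂]; exact hc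
      exact Or.inl (mem_cluster_of_adj hx₁ h₁)
    · -- an edge of the second side: `x ∈ V₂`, so `x = c` or `x` is in the `G₂`-cluster of `c`
      have hxV₂ : x ∈ V₂ := by
        obtain ⟨_, e, _, hends⟩ := openGraph_adj.1 h₂
        exact hg.mem₂ e x (by rw [hends]; exact Sym2.mem_mk_left x y)
      rcases hx with hx | ⟨hc, hx₂⟩
      · have hxV₁ : x ∈ V₁ := cluster_subset_of_mem hg hv hx
        have hxc : x = c := hg.inter x hxV₁ hxV₂
        subst hxc
        exact Or.inr ⟨hx, mem_cluster_of_adj (mem_cluster_self _ _ _) h₂⟩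
      · exact Or.inr ⟨hc, mem_cluster_of_adj hx₂ h₂⟩
  · rintro u (hu | ⟨hc, hu⟩)
    · exact conn_glue_of_conn₁ hu
    · exact conn_trans (conn_glue_of_conn₁ hc) (conn_glue_of_conn₂ hu)

/-- The symmetric decomposition for `v ∈ V₂`. -/
theorem cluster_glue_eq₂ (hg : IsGluing ends₁ ends₂ c V₁ V₂) {ζ : Config (E₁ ⊕ E₂)} {v : V}
    (hv : v ∈ V₂) :
    cluster (glue ends₁ ends₂) ζ v = cluster ends₂ (ζ ∘ Sum.inr) v ∪
      {x | c ∈ cluster ends₂ (ζ ∘ Sum.inr) v ∧ x ∈ cluster ends₁ (ζ ∘ Sum.inl) c} := by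
  have hg' : IsGluing ends₂ ends₁ c V₂ V₁ :=
    IsGluing.mk hg.c_mem₂ hg.c_mem₁ (fun x h₂ h₁ => hg.inter x h₁ h₂) hg.mem₂ hg.mem₁
  -- the glued graph with the sides exchanged
  have e : cluster (glue ends₁ ends₂) ζ v = cluster (glue ends₂ ends₁) (ζ ∘ Sum.swap) v := by
    ext u
    simp only [mem_cluster]
    constructor
    · intro h
      refine mem_of_conn_of_closed (ends := glue ends₁ ends₂) (ω := ζ) ?_ (mem_cluster_self _ _ _) h
      intro x hx y hxy
      refine mem_cluster_of_adj hx ?_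
      rcases adj_glue_iff.1 hxy with h₁ | h₂
      · exact adj_glue_iff.2 (Or.inr h₁)
      · exact adj_glue_iff.2 (Or.inl h₂)
    · intro h
      refine mem_of_conn_of_closed (ends := glue ends₂ ends₁) (ω := ζ ∘ Sum.swap) ?_
        (mem_cluster_self _ _ _) h
      intro x hx y hxy
      refine mem_cluster_of_adj hx ?_
      rcases adj_glue_iff.1 hxy with h₁ | h₂
      · exact adj_glue_iff.2 (Or.inr h₁)
      · exact adj_glue_iff.2 (Or.inl h₂)
  rw [e, cluster_glue_eq hg' hv]
  rfl


/-! ## Membership across the cut -/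

/-- The cluster of the cut vertex is the union of its two side clusters. -/
lemma cluster_glue_c (hg : IsGluing ends₁ ends₂ c V₁ V₂) (ζ : Config (E₁ ⊕ E₂)) :
    cluster (glue ends₁ ends₂) ζ c = cluster ends₁ (ζ ∘ Sum.inl) c ∪ cluster ends₂ (ζ ∘ Sum.inr) c := by
  rw [cluster_glue_eq hg hg.c_mem₁]
  ext x
  simp only [Set.mem_union, Set.mem_setOf_eq, mem_cluster_self, true_and]

/-- A vertex of the first side other than `c` is in the cluster of `v ∈ V₁` iff it is in the
`G₁`-cluster. -/
lemma mem_cluster_glue_iff₁ (hg : IsGluing ends₁ ends₂ c V₁ V₂) {ζ : Config (E₁ ⊕ E₂)} {v u : V}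
    (hv : v ∈ V₁) (hu : u ∈ V₁) (huc : u ≠ c) :
    u ∈ cluster (glue ends₁ ends₂) ζ v ↔ u ∈ cluster ends₁ (ζ ∘ Sum.inl) v := by
  rw [cluster_glue_eq hg hv]
  simp only [Set.mem_union, Set.mem_setOf_eq]
  constructor
  · rintro (h | ⟨_, h⟩)
    · exact h
    · exact absurd (hg.inter u hu (cluster_subset_of_mem₂ hg hg.c_mem₂ h)) huc
  · exact Or.inl

/-- A vertex of the second side other than `c` is in the cluster of `v ∈ V₁` iff the `G₁`-cluster of
`v` contains `c` and the `G₂`-cluster of `c` contains it. -/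
lemma mem_cluster_glue_iff_across (hg : IsGluing ends₁ ends₂ c V₁ V₂) {ζ : Config (E₁ ⊕ E₂)} {v u : V}
    (hv : v ∈ V₁) (hu : u ∈ V₂) (huc : u ≠ c) :
    u ∈ cluster (glue ends₁ ends₂) ζ v ↔
      c ∈ cluster ends₁ (ζ ∘ Sum.inl) v ∧ u ∈ cluster ends₂ (ζ ∘ Sum.inr) c := by
  rw [cluster_glue_eq hg hv]
  simp only [Set.mem_union, Set.mem_setOf_eq]
  constructor
  · rintro (h | h)
    · exact absurd (hg.inter u (cluster_subset_of_mem hg hv h) hu) huc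
    · exact h
  · exact Or.inr

/-- The symmetric statement: a vertex of the second side other than `c` is in the cluster of
`v ∈ V₂` iff it is in the `G₂`-cluster. -/
lemma mem_cluster_glue_iff₂ (hg : IsGluing ends₁ ends₂ c V₁ V₂) {ζ : Config (E₁ ⊕ E₂)} {v u : V}
    (hv : v ∈ V₂) (hu : u ∈ V₂) (huc : u ≠ c) :
    u ∈ cluster (glue ends₁ ends₂) ζ v ↔ u ∈ cluster ends₂ (ζ ∘ Sum.inr) v := by
  rw [cluster_glue_eq₂ hg hv]
  simp only [Set.mem_union, Set.mem_setOf_eq]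
  constructor
  · rintro (h | ⟨_, h⟩)
    · exact h
    · exact absurd (hg.inter u (cluster_subset_of_mem hg hg.c_mem₁ h) hu) huc
  · exact Or.inl

/-- `u ∈ C(v) ↔ v ∈ C(u)`. -/
lemma mem_cluster_comm {ends : E₁ → Sym2 V} {ω : Config E₁} {u v : V} :
    u ∈ cluster ends ω v ↔ v ∈ cluster ends ω u := by
  simp only [mem_cluster]; exact ⟨conn_symm, conn_symm⟩

/-! ## The colour swap of one side -/

/-- The colour swap of the second side. -/
def swap₂ (ζ : Config (E₁ ⊕ E₂)) : Config (E₁ ⊕ E₂) := Sum.elim (ζ ∘ Sum.inl) (blue (ζ ∘ Sum.inr))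

/-- The first side is kept. -/
lemma swap₂_inl (ζ : Config (E₁ ⊕ E₂)) : swap₂ ζ ∘ Sum.inl = ζ ∘ Sum.inl := rfl

/-- The second side is swapped. -/
lemma swap₂_inr (ζ : Config (E₁ ⊕ E₂)) : swap₂ ζ ∘ Sum.inr = blue (ζ ∘ Sum.inr) := rfl

/-- The blue colouring of the image on the first side. -/
lemma blue_swap₂_inl (ζ : Config (E₁ ⊕ E₂)) : blue (swap₂ ζ) ∘ Sum.inl = blue (ζ ∘ Sum.inl) := rfl

/-- The blue colouring of the image on the second side is the original. -/
lemma blue_swap₂_inr (ζ : Config (E₁ ⊕ E₂)) : blue (swap₂ ζ) ∘ Sum.inr = ζ ∘ Sum.inr := by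
  funext e; simp [swap₂, blue]

/-- `swap₂` is an involution. -/
lemma swap₂_swap₂ (ζ : Config (E₁ ⊕ E₂)) : swap₂ (swap₂ ζ) = ζ := by
  funext e; rcases e with e | e <;> simp [swap₂]

/-! ## Pairing a `G₁`-configuration with a `G₂`-configuration -/

/-- The configuration of the glued graph with the given sides. -/
def pair (ζ₁ : Config E₁) (ζ₂ : Config E₂) : Config (E₁ ⊕ E₂) := Sum.elim ζ₁ ζ₂

/-- The first side of a pair. -/
lemma pair_inl (ζ₁ : Config E₁) (ζ₂ : Config E₂) : pair ζ₁ ζ₂ ∘ Sum.inl = ζ₁ := rfl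

/-- The second side of a pair. -/
lemma pair_inr (ζ₁ : Config E₁) (ζ₂ : Config E₂) : pair ζ₁ ζ₂ ∘ Sum.inr = ζ₂ := rfl

/-- The blue colouring of a pair is the pair of the blue colourings. -/
lemma blue_pair (ζ₁ : Config E₁) (ζ₂ : Config E₂) : blue (pair ζ₁ ζ₂) = pair (blue ζ₁) (blue ζ₂) := by
  funext e; rcases e with e | e <;> rfl

/-- A configuration of the glued graph is the pair of its sides. -/
lemma pair_comp (ζ : Config (E₁ ⊕ E₂)) : pair (ζ ∘ Sum.inl) (ζ ∘ Sum.inr) = ζ := by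
  funext e; rcases e with e | e <;> rfl

variable [Fintype E₁] [Fintype E₂] [DecidableEq E₁] [DecidableEq E₂]

/-- Membership in `tgtU` of the glued graph, unfolded. -/
lemma mem_tgtU_glue_iff {l h o : V} {ζ : Config (E₁ ⊕ E₂)} :
    ζ ∈ tgtU (glue ends₁ ends₂) l h {S : Set V | o ∈ S} ↔
      (h ∉ cluster (glue ends₁ ends₂) ζ l ∧ h ∉ cluster (glue ends₁ ends₂) (blue ζ) l) ∧
        o ∈ cluster (glue ends₁ ends₂) ζ l ∧ o ∉ cluster (glue ends₁ ends₂) (blue ζ) l := by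
  simp only [tgtU, Finset.mem_filter, Finset.mem_univ, true_and, mem_hull_iff, Set.mem_setOf_eq,
    not_or]

/-- **(SW) across a cut at `l`** (`c = l`, `o` on the first side, `h` on the second): the colour swap
of the `h`-side is an (SW) permutation — no hypothesis on the sides. -/
theorem sw_glue_cut_l {l h o : V} (hg : IsGluing ends₁ ends₂ l V₁ V₂) (ho : o ∈ V₁) (hol : o ≠ l)
    (hh : h ∈ V₂) (hhl : h ≠ l) : Sw (glue ends₁ ends₂) l h o := by
  have key : ∀ ζ : Config (E₁ ⊕ E₂),
      ζ ∈ tgtU (glue ends₁ ends₂) l h {S : Set V | o ∈ S} ↔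
        (h ∉ cluster ends₂ (ζ ∘ Sum.inr) l ∧ h ∉ cluster ends₂ (blue (ζ ∘ Sum.inr)) l) ∧
          o ∈ cluster ends₁ (ζ ∘ Sum.inl) l ∧ o ∉ cluster ends₁ (blue (ζ ∘ Sum.inl)) l := by
    intro ζ
    rw [mem_tgtU_glue_iff, mem_cluster_glue_iff₁ hg hg.c_mem₁ ho hol,
      mem_cluster_glue_iff₁ hg hg.c_mem₁ ho hol, mem_cluster_glue_iff₂ hg hg.c_mem₂ hh hhl,
      mem_cluster_glue_iff₂ hg hg.c_mem₂ hh hhl, blue_comp_inl, blue_comp_inr]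
  refine ⟨fun x => swap₂ x.1, ?_, ?_⟩
  · intro x y hxy
    have := congrArg swap₂ hxy
    simp only [swap₂_swap₂] at this
    exact Subtype.ext this
  · intro x
    have hx := (key x.1).1 x.2
    refine ⟨(key _).2 ?_, ?_⟩
    · rw [swap₂_inl, swap₂_inr, blue_blue]
      exact ⟨⟨hx.1.2, hx.1.1⟩, hx.2⟩
    · -- the red cluster of `h` lives on the second side and survives as the blue cluster of the image
      intro u hu
      rw [cluster_glue_eq₂ hg hh] at hu
      rw [cluster_glue_eq₂ hg hh, blue_swap₂_inr]
      rcases hu with hu | ⟨hl, _⟩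
      · exact Or.inl hu
      · exact absurd (mem_cluster_comm.1 hl) hx.1.1

/-- **(SW) with a pendant side**: `l, h, o` on the first side, the second side attached at `c`;
(SW) on the first side gives (SW) on the glued graph (the image swaps the pendant side). -/
theorem sw_glue_pendant {l h o : V} (hg : IsGluing ends₁ ends₂ c V₁ V₂) (hl : l ∈ V₁) (hh : h ∈ V₁)
    (hhc : h ≠ c) (ho : o ∈ V₁) (hoc : o ≠ c) (h₁ : Sw ends₁ l h o) : Sw (glue ends₁ ends₂) l h o := by
  obtain ⟨f₁, hf₁, hmem₁⟩ := h₁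
  have key : ∀ ζ : Config (E₁ ⊕ E₂),
      ζ ∈ tgtU (glue ends₁ ends₂) l h {S : Set V | o ∈ S} ↔
        ζ ∘ Sum.inl ∈ tgtU ends₁ l h {S : Set V | o ∈ S} := by
    intro ζ
    rw [mem_tgtU_glue_iff, mem_cluster_glue_iff₁ hg hl hh hhc, mem_cluster_glue_iff₁ hg hl hh hhc,
      mem_cluster_glue_iff₁ hg hl ho hoc, mem_cluster_glue_iff₁ hg hl ho hoc, blue_comp_inl]
    simp only [tgtU, Finset.mem_filter, Finset.mem_univ, true_and, mem_hull_iff, Set.mem_setOf_eq,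
      not_or]
  refine ⟨fun x => pair (f₁ ⟨x.1 ∘ Sum.inl, (key _).1 x.2⟩) (blue (x.1 ∘ Sum.inr)), ?_, ?_⟩
  · intro x y hxy
    have h1 := congrArg (fun ζ => ζ ∘ Sum.inl) hxy
    have h2 := congrArg (fun ζ => ζ ∘ Sum.inr) hxy
    simp only [pair_inl, pair_inr] at h1 h2
    have h1' : x.1 ∘ Sum.inl = y.1 ∘ Sum.inl := congrArg Subtype.val (hf₁ h1)
    have h2' : x.1 ∘ Sum.inr = y.1 ∘ Sum.inr := by
      have := congrArg blue h2
      simpa only [blue_blue] using this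
    apply Subtype.ext
    rw [← pair_comp x.1, ← pair_comp y.1, h1', h2']
  · intro x
    obtain ⟨ht, hsub⟩ := hmem₁ ⟨x.1 ∘ Sum.inl, (key _).1 x.2⟩
    refine ⟨(key _).2 (by rw [pair_inl]; exact ht), ?_⟩
    intro u hu
    rw [cluster_glue_eq hg hh] at hu
    rw [cluster_glue_eq hg hh, blue_pair, pair_inl, pair_inr, blue_blue]
    rcases hu with hu | ⟨hc, hu⟩
    · exact Or.inl (hsub hu)
    · exact Or.inr ⟨hsub hc, hu⟩

/-- **(SW) across a cut at `h`** (`c = h`, `l, o` on the first side): (SW) on the first side gives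
(SW) on the glued graph (the red cluster of `h` is the union of its side clusters). -/
theorem sw_glue_cut_h {l h o : V} (hg : IsGluing ends₁ ends₂ h V₁ V₂) (hl : l ∈ V₁) (ho : o ∈ V₁) (hoh : o ≠ h) (h₁ : Sw ends₁ l h o) : Sw (glue ends₁ ends₂) l h o := by
  obtain ⟨f₁, hf₁, hmem₁⟩ := h₁
  have hmem_h : ∀ ζ : Config (E₁ ⊕ E₂),
      h ∈ cluster (glue ends₁ ends₂) ζ l ↔ h ∈ cluster ends₁ (ζ ∘ Sum.inl) l := by
    intro ζ
    rw [cluster_glue_eq hg hl]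
    simp only [Set.mem_union, Set.mem_setOf_eq]
    constructor
    · rintro (h' | ⟨h', _⟩) <;> exact h'
    · exact Or.inl
  have key : ∀ ζ : Config (E₁ ⊕ E₂),
      ζ ∈ tgtU (glue ends₁ ends₂) l h {S : Set V | o ∈ S} ↔
        ζ ∘ Sum.inl ∈ tgtU ends₁ l h {S : Set V | o ∈ S} := by
    intro ζ
    rw [mem_tgtU_glue_iff, hmem_h, hmem_h, mem_cluster_glue_iff₁ hg hl ho hoh,
      mem_cluster_glue_iff₁ hg hl ho hoh, blue_comp_inl]
    simp only [tgtU, Finset.mem_filter, Finset.mem_univ, true_and, mem_hull_iff, Set.mem_setOf_eq,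
      not_or]
  refine ⟨fun x => pair (f₁ ⟨x.1 ∘ Sum.inl, (key _).1 x.2⟩) (blue (x.1 ∘ Sum.inr)), ?_, ?_⟩
  · intro x y hxy
    have h1 := congrArg (fun ζ => ζ ∘ Sum.inl) hxy
    have h2 := congrArg (fun ζ => ζ ∘ Sum.inr) hxy
    simp only [pair_inl, pair_inr] at h1 h2
    have h1' : x.1 ∘ Sum.inl = y.1 ∘ Sum.inl := congrArg Subtype.val (hf₁ h1)
    have h2' : x.1 ∘ Sum.inr = y.1 ∘ Sum.inr := by
      have := congrArg blue h2
      simpa only [blue_blue] using this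
    apply Subtype.ext
    rw [← pair_comp x.1, ← pair_comp y.1, h1', h2']
  · intro x
    obtain ⟨ht, hsub⟩ := hmem₁ ⟨x.1 ∘ Sum.inl, (key _).1 x.2⟩
    refine ⟨(key _).2 (by rw [pair_inl]; exact ht), ?_⟩
    intro u hu
    rw [cluster_glue_c hg] at hu
    rw [cluster_glue_c hg, blue_pair, pair_inl, pair_inr, blue_blue]
    rcases hu with hu | hu
    · exact Or.inl (hsub hu)
    · exact Or.inr hu

end Glue

end Summit.Ventures.PercRepro2
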